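import Mathlib.Combinatorics.SetFamily.Compression.Down
import Mathlib.Tactic
import HarnessLib
import HarnessLib.Audit.Tags
import Summits.CriticalPhenomena.PercolationContinuityZ3.Theorems.PercNearOneGluingNoHeavyLowerTailSahiRainbowTwoColour

/-!
# The two-colouring statement compresses, I: the UPPER-COLOURED doubled configuration (key lemma) and the derived configurations

Support file (seat `prim-masterthm-p1`, gen 41; `--supports stmt-CriticalPhenomena-4575`).  No `sorry`, standard axioms.
Memo `run/shared/lean/prim/prim-masterthm/FROM-prim-masterthm-p1-g41-TWO-COLOUR.md` §2–§4.

SETTING (`…SahiRainbowTwoColour`): `Z = X ⊔ Y ⊆ 2^G` complement-closed, `L = monoMeets X Y` (monochromatic meets of distinct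
members, `∅` adjoined).  Fix `y ∈ G` and write `bothLifts W y = W.memberSubfamily y ∩ W.nonMemberSubfamily y` for the `y`-free
members `w` of a family `W` with `insert y w ∈ W` as well: `D = bothLifts Z y` are the DOUBLED members (`#D = 2 p_y`),
`bothLifts L y` are the TWINS (colours `w ∌ y` with `insert y w` also a colour).  Always `#L = #(L.image (·.erase y)) + #twins`
and `#Z = #(Z.image (·.erase y)) + #D` (`card_image_erase_add_card_bothLifts`).

NEW HERE ([this work], gen 41).
* `pairMeets_upperClass_subset_twins` — **THE KEY LEMMA.**  Colour `D` by the UPPER colour (`d ↦` the colour of `insert y d`):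
  `DX = {d ∈ D : insert y d ∈ X}`, `DY = {d ∈ D : insert y d ∈ Y}`.  Then EVERY monochromatic meet of two distinct members of
  `(DX, DY)` is a twin: `pairMeets DX ∪ pairMeets DY ⊆ bothLifts L y`.  (Upper lift: `insert y d ∩ insert y d'`; lower lift: if
  `d, d'` have the same LOWER colour use `d ∩ d'`, otherwise — two colours! — one of `d, d'` has lower colour equal to the common
  upper colour and `d ∩ insert y d' = d ∩ d'` is monochromatic; the two classes need not even be disjoint.)  And `(DX, DY)` is again a 2-coloured complement-closed family on
  `G.erase y` (`upperClass_config`), of size `#D`; so the statement `TwoColourMeets` on `G.erase y` bounds the twins from below —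
  gen 40's three-family inequality M3♯ is thereby ITS OWN inductive hypothesis (no separate conjecture).
* `monoMeets_proj_subset` — the projected configuration `(X', Y') = (X.image erase, Y.image erase \ X.image erase)` (conflicts
  resolved towards `X`) is a 2-coloured complement-closed family on `G.erase y` of size `#Z - #D` whose colours are projections of
  colours of `(X, Y)`.
(Companion file `…SahiRainbowTwoColourSparse`: the step at a good point, the twin-point form, the typed sparse residual
`SparseTwoColourMeets` and `SparseTwoColourMeets ⟹ TwoColourMeets ⟹ RainbowMeetCojoin`.)
HONEST FRAMING: `TwoColourMeets` and `RainbowMeetCojoin` remain OPEN; the lemmas of this file are unconditional. [this work]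
-/

namespace Summit.CriticalPhenomena.PercolationContinuityZ3.Theorems.SahiColouredDaykin

open Finset
open scoped FinsetFamily

variable {α : Type*} [DecidableEq α]

/-! ### 1. Both lifts: doubled members and twins -/

/-- The `y`-free members `w` of `W` with `insert y w ∈ W` as well (doubled members of a family / twins of a colour set). [this work] -/
def bothLifts (W : Finset (Finset α)) (y : α) : Finset (Finset α) := W.memberSubfamily y ∩ W.nonMemberSubfamily y

/-- Unpacking membership in `bothLifts`. [this work] -/
theorem mem_bothLifts {W : Finset (Finset α)} {y : α} {w : Finset α} :
    w ∈ bothLifts W y ↔ y ∉ w ∧ w ∈ W ∧ insert y w ∈ W := by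
  unfold bothLifts
  rw [mem_inter, mem_memberSubfamily, mem_nonMemberSubfamily]
  tauto

/-- Members with both lifts are in particular (projected) members. [this work] -/
theorem bothLifts_subset_image_erase (W : Finset (Finset α)) (y : α) : bothLifts W y ⊆ W.image fun s => s.erase y := by
  intro w hw
  obtain ⟨hyw, hwW, _⟩ := mem_bothLifts.1 hw
  exact mem_image.2 ⟨w, hwW, erase_eq_of_notMem hyw⟩

/-- **The fibre count**: `#(W.image (·.erase y)) + #(bothLifts W y) = #W`. [this work] -/
theorem card_image_erase_add_card_bothLifts (W : Finset (Finset α)) (y : α) :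
    #(W.image fun s => s.erase y) + #(bothLifts W y) = #W := by
  rw [← memberSubfamily_union_nonMemberSubfamily, bothLifts, card_union_add_card_inter,
    card_memberSubfamily_add_card_nonMemberSubfamily]

/-- The doubled members of `Z` at `y` whose UPPER lift `insert y d` lies in the colour class `C`. [this work] -/
def upperClass (Z C : Finset (Finset α)) (y : α) : Finset (Finset α) := (bothLifts Z y).filter fun d => insert y d ∈ C

/-! ### 2. The key lemma: upper-coloured meets of doubled members are twins -/

section Key

/-- **KEY LEMMA.**  Every meet of two distinct doubled members whose upper lifts lie in `X` is a TWIN of `monoMeets X Y`.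
[this work] -/
theorem pairMeets_upperClass_subset_twins (X Y : Finset (Finset α)) (y : α) :
    pairMeets (upperClass (X ∪ Y) X y) ⊆ bothLifts (monoMeets X Y) y := by
  intro w hw
  obtain ⟨d, hd, d', hd', hdd', rfl⟩ := mem_pairMeets.1 hw
  obtain ⟨hdD, hdX⟩ := mem_filter.1 hd
  obtain ⟨hd'D, hd'X⟩ := mem_filter.1 hd'
  obtain ⟨hyd, hdZ, -⟩ := mem_bothLifts.1 hdD
  obtain ⟨hyd', hd'Z, -⟩ := mem_bothLifts.1 hd'D
  rw [mem_bothLifts]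
  refine ⟨fun h => hyd (mem_inter.1 h).1, ?_, ?_⟩
  · -- the lower lift `d ∩ d'`
    rcases mem_union.1 hdZ with hdX0 | hdY0 <;> rcases mem_union.1 hd'Z with hd'X0 | hd'Y0
    · exact mem_monoMeets.2 (Or.inr (Or.inl (inter_mem_pairMeets hdX0 hd'X0 hdd')))
    · have hne : d ≠ insert y d' := fun h => hyd (h ▸ mem_insert_self y d')
      have e : d ∩ d' = d ∩ insert y d' := by
        ext t; simp only [mem_inter, mem_insert]
        constructor
        · rintro ⟨h1, h2⟩; exact ⟨h1, Or.inr h2⟩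
        · rintro ⟨h1, h2 | h2⟩
          · exact absurd h1 (h2 ▸ hyd)
          · exact ⟨h1, h2⟩
      rw [e]; exact mem_monoMeets.2 (Or.inr (Or.inl (inter_mem_pairMeets hdX0 hd'X hne)))
    · have hne : insert y d ≠ d' := fun h => hyd' (h ▸ mem_insert_self y d)
      have e : d ∩ d' = insert y d ∩ d' := by
        ext t; simp only [mem_inter, mem_insert]
        constructor
        · rintro ⟨h1, h2⟩; exact ⟨Or.inr h1, h2⟩
        · rintro ⟨h1 | h1, h2⟩
          · exact absurd h2 (h1 ▸ hyd')
          · exact ⟨h1, h2⟩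
      rw [e]; exact mem_monoMeets.2 (Or.inr (Or.inl (inter_mem_pairMeets hdX hd'X0 hne)))
    · exact mem_monoMeets.2 (Or.inr (Or.inr (inter_mem_pairMeets hdY0 hd'Y0 hdd')))
  · -- the upper lift `insert y d ∩ insert y d'`
    have hne : insert y d ≠ insert y d' := fun h => hdd' (by rw [← erase_insert hyd, h, erase_insert hyd'])
    have e : insert y (d ∩ d') = insert y d ∩ insert y d' := by
      ext t; simp only [mem_insert, mem_inter]; tauto
    rw [e]; exact mem_monoMeets.2 (Or.inr (Or.inl (inter_mem_pairMeets hdX hd'X hne)))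

/-- **KEY LEMMA, both classes.**  All monochromatic meets of the upper-coloured doubled configuration are twins. [this work] -/
theorem pairMeets_upperClass_union_subset_twins (X Y : Finset (Finset α)) (y : α) :
    pairMeets (upperClass (X ∪ Y) X y) ∪ pairMeets (upperClass (X ∪ Y) Y y) ⊆ bothLifts (monoMeets X Y) y := by
  apply union_subset (pairMeets_upperClass_subset_twins X Y y)
  have := pairMeets_upperClass_subset_twins Y X y
  rwa [union_comm Y X, monoMeets_comm Y X] at this

end Key

/-! ### 3. The two derived configurations on `G.erase y` -/

section Derived

variable {G : Finset α} {X Y : Finset (Finset α)} {y : α}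

/-- Complement in `G.erase y` of a `y`-free set, two ways. [this work] -/
theorem erase_sdiff_eq_sdiff_insert (G d : Finset α) (y : α) : (G.erase y) \ d = G \ insert y d := by
  ext t; simp only [mem_sdiff, mem_erase, mem_insert]; tauto

/-- The doubled family is complement-closed in `G.erase y` (for `y ∈ G`). [this work] -/
theorem sdiff_mem_bothLifts (hy : y ∈ G) (hcc : ∀ z ∈ X ∪ Y, G \ z ∈ X ∪ Y) {d : Finset α}
    (hd : d ∈ bothLifts (X ∪ Y) y) : (G.erase y) \ d ∈ bothLifts (X ∪ Y) y := by
  obtain ⟨hyd, hdZ, hdZ'⟩ := mem_bothLifts.1 hd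
  rw [mem_bothLifts]
  refine ⟨fun h => (notMem_erase y G) (mem_sdiff.1 h).1, ?_, ?_⟩
  · rw [erase_sdiff_eq_sdiff_insert]; exact hcc _ hdZ'
  · have e : insert y ((G.erase y) \ d) = G \ d := by
      ext t; simp only [mem_insert, mem_sdiff, mem_erase]
      constructor
      · rintro (rfl | ⟨⟨_, htG⟩, htd⟩)
        · exact ⟨hy, hyd⟩
        · exact ⟨htG, htd⟩
      · rintro ⟨htG, htd⟩
        by_cases hty : t = y
        · exact Or.inl hty
        · exact Or.inr ⟨⟨hty, htG⟩, htd⟩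
    rw [e]; exact hcc _ hdZ

/-- The upper classes partition the doubled family. [this work] -/
theorem upperClass_union (X Y : Finset (Finset α)) (y : α) :
    upperClass (X ∪ Y) X y ∪ upperClass (X ∪ Y) Y y = bothLifts (X ∪ Y) y := by
  ext d
  simp only [upperClass, mem_union, mem_filter]
  constructor
  · rintro (⟨h, _⟩ | ⟨h, _⟩) <;> exact h
  · intro h
    rcases mem_union.1 (mem_bothLifts.1 h).2.2 with h' | h'
    · exact Or.inl ⟨h, h'⟩
    · exact Or.inr ⟨h, h'⟩

/-- The upper classes are disjoint. [this work] -/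
theorem disjoint_upperClass (hXY : Disjoint X Y) (y : α) : Disjoint (upperClass (X ∪ Y) X y) (upperClass (X ∪ Y) Y y) := by
  rw [disjoint_left]
  intro d hd hd'
  exact disjoint_left.1 hXY (mem_filter.1 hd).2 (mem_filter.1 hd').2

/-- **The upper-coloured doubled configuration is a 2-coloured complement-closed family on `G.erase y`.** [this work] -/
theorem upperClass_config (hy : y ∈ G) (hZG : ∀ z ∈ X ∪ Y, z ⊆ G) (hcc : ∀ z ∈ X ∪ Y, G \ z ∈ X ∪ Y) (hXY : Disjoint X Y) :
    (∀ d ∈ upperClass (X ∪ Y) X y ∪ upperClass (X ∪ Y) Y y, d ⊆ G.erase y) ∧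
    (∀ d ∈ upperClass (X ∪ Y) X y ∪ upperClass (X ∪ Y) Y y,
        (G.erase y) \ d ∈ upperClass (X ∪ Y) X y ∪ upperClass (X ∪ Y) Y y) ∧
    Disjoint (upperClass (X ∪ Y) X y) (upperClass (X ∪ Y) Y y) := by
  rw [upperClass_union]
  refine ⟨fun d hd => ?_, fun d hd => sdiff_mem_bothLifts hy hcc hd, disjoint_upperClass hXY y⟩
  obtain ⟨hyd, hdZ, -⟩ := mem_bothLifts.1 hd
  intro t ht
  exact mem_erase.2 ⟨fun h => hyd (h ▸ ht), hZG d hdZ ht⟩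

/-- The projected configuration covers all projections. [this work] -/
theorem proj_union (X Y : Finset (Finset α)) (y : α) :
    (X.image fun s => s.erase y) ∪ ((Y.image fun s => s.erase y) \ X.image fun s => s.erase y) =
      (X ∪ Y).image fun s => s.erase y := by
  rw [union_sdiff_self_eq_union, image_union]

/-- **The projected configuration is a 2-coloured complement-closed family on `G.erase y`.** [this work] -/
theorem proj_config (hZG : ∀ z ∈ X ∪ Y, z ⊆ G) (hcc : ∀ z ∈ X ∪ Y, G \ z ∈ X ∪ Y) :
    (∀ w ∈ (X.image fun s => s.erase y) ∪ ((Y.image fun s => s.erase y) \ X.image fun s => s.erase y), w ⊆ G.erase y) ∧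
    (∀ w ∈ (X.image fun s => s.erase y) ∪ ((Y.image fun s => s.erase y) \ X.image fun s => s.erase y),
      (G.erase y) \ w ∈ (X.image fun s => s.erase y) ∪ ((Y.image fun s => s.erase y) \ X.image fun s => s.erase y)) ∧
    Disjoint (X.image fun s => s.erase y) ((Y.image fun s => s.erase y) \ X.image fun s => s.erase y) := by
  rw [proj_union]
  refine ⟨fun w hw => ?_, fun w hw => ?_, disjoint_sdiff⟩
  · obtain ⟨z, hz, rfl⟩ := mem_image.1 hw
    exact erase_subset_erase y (hZG z hz)
  · obtain ⟨z, hz, rfl⟩ := mem_image.1 hw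
    refine mem_image.2 ⟨G \ z, hcc z hz, ?_⟩
    ext t; simp only [mem_erase, mem_sdiff]; tauto

/-- The colours of the projected configuration are projections of colours. [this work] -/
theorem monoMeets_proj_subset (X Y : Finset (Finset α)) (y : α) :
    monoMeets (X.image fun s => s.erase y) ((Y.image fun s => s.erase y) \ X.image fun s => s.erase y) ⊆
      (monoMeets X Y).image fun s => s.erase y := by
  have key : ∀ (C : Finset (Finset α)), C ⊆ X ∪ Y → pairMeets C ⊆ pairMeets X ∪ pairMeets Y →
      pairMeets (C.image fun s => s.erase y) ⊆ (monoMeets X Y).image fun s => s.erase y := by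
    intro C _ hC w hw
    obtain ⟨a', ha', b', hb', hab', rfl⟩ := mem_pairMeets.1 hw
    obtain ⟨a, ha, rfl⟩ := mem_image.1 ha'
    obtain ⟨b, hb, rfl⟩ := mem_image.1 hb'
    have hab : a ≠ b := fun h => hab' (by rw [h])
    refine mem_image.2 ⟨a ∩ b, ?_, ?_⟩
    · have := hC (inter_mem_pairMeets ha hb hab)
      rcases mem_union.1 this with h | h
      · exact mem_monoMeets.2 (Or.inr (Or.inl h))
      · exact mem_monoMeets.2 (Or.inr (Or.inr h))
    · ext t; simp only [mem_erase, mem_inter]; tauto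
  intro w hw
  rcases mem_monoMeets.1 hw with rfl | hw | hw
  · exact mem_image.2 ⟨∅, empty_mem_monoMeets X Y, rfl⟩
  · exact key X subset_union_left (subset_union_left) hw
  · have hsub : (Y.image fun s => s.erase y) \ (X.image fun s => s.erase y) ⊆ Y.image fun s => s.erase y := sdiff_subset
    exact key Y subset_union_right subset_union_right (pairMeets_mono hsub hw)

end Derived

end Summit.CriticalPhenomena.PercolationContinuityZ3.Theorems.SahiColouredDaykin
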